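import Summits.Schanuel.Schanuel.Theses.RootDecomp1
import Literature.NumberTheory.Transcendental.OneMotiveToric
import Literature.NumberTheory.Transcendental.PhilipponCriterionProofs
import Literature.NumberTheory.Transcendental.LindemannWeierstrassProofs
import Literature.Barriers.Schanuel.AlgebraicIndependenceOfLogarithms
import Literature.RingTheory.MvPolynomial.RuppertReducibleProofs

/-!
# RootDecomp1 — COLLAPSE OF THE PARAMETRISATION LADDER: `B ∧ U⊥ ⟹ L ∧ Q`
(cell `decomp-schanuel`, lens-1 gen 12 kernel `LadderCollapse.lean`, ported for `Theorems/`)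

Route `RootDecomp1` (rev 20) decides Schanuel from SEVEN binders
`closes (h₂ : S₂) (hK : K) (hD : B) (hL : L) (hQ : Q) (hU : U⊥) (hC : Cⁿᵘ) : Schanuel`, where
B = `DefectOneSchanuel`, L = `LinearSchanuel` (Schanuel against ℚ̄-affine images of < n parameters),
Q = `QuadraticSchanuel` (against ℚ̄-quadratic images, stated orthogonally to L), U⊥ =
`RationalImageSchanuel` (against ℚ̄-rational images, at TIGHT tuples, stated orthogonally to L and Q).

THEOREM (this file, 0 sorry).  `DefectOneSchanuel → RationalImageSchanuel → LinearSchanuel` and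
`DefectOneSchanuel → RationalImageSchanuel → QuadraticSchanuel`; more generally
(`collapse_core`) B ∧ U⊥ give Schanuel at every ℚ-l.i. `z` whose coordinates are ℚ̄-POLYNOMIALS OF
BOUNDED DEGREE and whose exponentials are arbitrary ℚ̄-polynomials in k common parameters (n ≤ k).
USE IN THE ROUTE.  Either (M1) the gate credits `linearSchanuel_of_defectOne_rationalImage` /
`quadraticSchanuel_of_defectOne_rationalImage` as proofs of the items L (stmt-Schanuel-27145) and
Q (stmt-Schanuel-28369) modulo the registered items B, U⊥ (H21 audit class `proof-of-item`), or (M2) the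
route gains the support item `LadderCollapseGlue : DefectOneSchanuel → RationalImageSchanuel →
(LinearSchanuel ∧ QuadraticSchanuel)`, closed by the two-line corollary
`fun hB hU => ⟨linearSchanuel_of_defectOne_rationalImage hB hU, quadraticSchanuel_of_defectOne_rationalImage hB hU⟩`
(appended to this file once the decl exists), and the deciding theorem takes `hG : LadderCollapseGlue`
instead of `hL`, `hQ`.  Either way the open cone of `RootDecomp1` loses the rows L and Q.

MECHANISM (padding).  Let z be a counterexample to L or Q: z ⊂ ℚ̄[t]_{≤2}, e^z ⊂ ℚ̄[t], k < n.
B forces k = n − 1 and t algebraically independent (`numerics`: trdeg ℚ(z, e^z) ≤ trdeg ℚ(t) ≤ k and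
n ≤ trdeg + 1).  PAD z by the two monomials t₀³, t₀⁴: the tuple x = (z, t₀³, t₀⁴) is ℚ-l.i.
(`linearIndependent_pad`: a relation would be a polynomial identity over ℚ̄ whose degree-3 and
degree-4 coefficients isolate the padding), (x, e^x) is a ℚ̄-POLYNOMIAL image of the k + 2 numbers
(t, e^{t₀³}, e^{t₀⁴}), x is tight by B, and x is affinely AND quadratically NON-degenerate
(`pad_quadratic_clause`: a quadratic parametrisation of x by k' < n + 2 numbers t' is, by B again, one by
n + 1 algebraically independent numbers, and then t₀³ = P(t'), t₀⁴ = Q(t') with deg P, deg Q ≤ 2 give the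
identity P⁴ = Q³ in the polynomial ring ℚ̄[T'], whose degrees force P constant — `gadget_rigid` — so t₀
would be algebraic).  U⊥ at x yields n + 2 ≤ k + 2, i.e. L and Q at z.  The case k = 0 is
Hermite–Lindemann (`transcendental_exp_holds`).

READING FOR THE CELL.  The rows L (stmt-27145) and Q (stmt-28369) are IMPLIED by the rows B (25020) and U⊥ (29644); the «orthogonality clauses» typed into
U⊥ do not prevent U⊥'s class (tight rational-image tuples of ANY length) from containing paddings of
every affine / quadratic atom.  The parametrisation-degree ladder U₁ ⊂ U₂ ⊂ … ⊂ U_rat of gens 3–5 thus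
COLLAPSES to its top rung modulo B.  Nothing here is a statement about the truth of any row.
-/

noncomputable section

set_option linter.dupNamespace false

namespace Summit.Schanuel.Schanuel.Theorems.RootDecomp1LadderCollapse

open Complex IntermediateField
open scoped BigOperators
open Summit.Schanuel.Schanuel.Theses.RootDecomp1 (DefectOneSchanuel LinearSchanuel QuadraticSchanuel
  RationalImageSchanuel)
open Literature.NumberTheory.Transcendental (transcendental_exp_holds)
open Literature.NumberTheory.Transcendental.OneMotiveToric (trdeg_mono)
open Literature.NumberTheory.Transcendental.Philippon1986_criterion (trdeg_adjoin_range_le)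
open Literature.RingTheory.MvPolynomial.Ruppert (totalDegree_pow_of_ne_zero)
open Literature.Barriers.Schanuel (algebraicIndependent_of_le_trdeg_adjoin
  trdeg_adjoin_union_eq_of_isAlgebraic)

/-! ## 1. Polynomials over the subalgebra `ℚ̄ ⊂ ℂ` of algebraic numbers -/

/-- The ℚ-subalgebra of `ℂ` of algebraic numbers (Mathlib's `Subalgebra.algebraicClosure`). -/
abbrev Qbar : Subalgebra ℚ ℂ := Subalgebra.algebraicClosure ℚ ℂ

/-- A polynomial with algebraic coefficients, evaluated at `t`, lies in the field `ℚ(t, ℚ̄)`. -/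
theorem aeval_mem_adjoin {k : ℕ} (t : Fin k → ℂ) (P : MvPolynomial (Fin k) Qbar) :
    MvPolynomial.aeval t P ∈ adjoin ℚ (Set.range t ∪ {y : ℂ | IsAlgebraic ℚ y}) := by
  induction P using MvPolynomial.induction_on with
  | C a =>
    rw [MvPolynomial.aeval_C, Subalgebra.algebraMap_def]
    exact subset_adjoin ℚ _ (Set.mem_union_right _ a.2)
  | add p q hp hq => rw [map_add]; exact add_mem hp hq
  | mul_X p j hp =>
    rw [map_mul, MvPolynomial.aeval_X]
    exact mul_mem hp (subset_adjoin ℚ _ (Set.mem_union_left _ ⟨j, rfl⟩))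

/-- If `z` and `e^z` are ℚ̄-polynomials in `t` then `trdeg ℚ(z, e^z) ≤ trdeg ℚ(t)`. -/
theorem trdeg_le_of_aeval {n k : ℕ} (z : Fin n → ℂ) (t : Fin k → ℂ)
    (N E : Fin n → MvPolynomial (Fin k) Qbar)
    (hzN : ∀ i, z i = MvPolynomial.aeval t (N i)) (hzE : ∀ i, cexp (z i) = MvPolynomial.aeval t (E i)) :
    Algebra.trdeg ℚ ↥(adjoin ℚ (Set.range z ∪ Set.range (cexp ∘ z))) ≤
      Algebra.trdeg ℚ ↥(adjoin ℚ (Set.range t)) := by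
  set T : Set ℂ := {y : ℂ | IsAlgebraic ℚ y} with hT
  have hsub : Set.range z ∪ Set.range (cexp ∘ z) ⊆ (adjoin ℚ (Set.range t ∪ T) : Set ℂ) := by
    rintro x (⟨i, rfl⟩ | ⟨i, rfl⟩)
    · rw [hzN i]; exact aeval_mem_adjoin t (N i)
    · simp only [Function.comp_apply]; rw [hzE i]; exact aeval_mem_adjoin t (E i)
  calc Algebra.trdeg ℚ ↥(adjoin ℚ (Set.range z ∪ Set.range (cexp ∘ z)))
      ≤ Algebra.trdeg ℚ ↥(adjoin ℚ (Set.range t ∪ T)) := trdeg_mono (adjoin_le_iff.mpr hsub)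
    _ = Algebra.trdeg ℚ ↥(adjoin ℚ (Set.range t)) :=
        trdeg_adjoin_union_eq_of_isAlgebraic (K := ℚ) (Set.range t) T (fun x hx => hx)

/-- `trdeg ℚ(t₁, …, t_k)` is a natural number `≤ k`. -/
theorem exists_nat_trdeg_range {k : ℕ} (t : Fin k → ℂ) :
    ∃ m : ℕ, Algebra.trdeg ℚ ↥(adjoin ℚ (Set.range t)) = m ∧ m ≤ k := by
  have hle := trdeg_adjoin_range_le (F := ℚ) t
  obtain ⟨m, hm⟩ := Cardinal.lt_aleph0.1 (hle.trans_lt (Cardinal.natCast_lt_aleph0 (n := k)))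
  refine ⟨m, hm, ?_⟩
  rw [hm] at hle
  exact_mod_cast hle

/-- **Numerics forced by B.**  If B holds and a ℚ-l.i. `z` of length `n > k` is ℚ̄-polynomially
parametrised (with its exponentials) by `t : Fin k → ℂ`, then `n = k + 1` and `t` is algebraically
independent over ℚ. -/
theorem numerics (hB : DefectOneSchanuel) {n k : ℕ} (z : Fin n → ℂ) (t : Fin k → ℂ)
    (hz : LinearIndependent ℚ z) (N E : Fin n → MvPolynomial (Fin k) Qbar)
    (hzN : ∀ i, z i = MvPolynomial.aeval t (N i)) (hzE : ∀ i, cexp (z i) = MvPolynomial.aeval t (E i))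
    (hkn : k < n) : n = k + 1 ∧ AlgebraicIndependent ℚ t := by
  obtain ⟨m, hm, hmk⟩ := exists_nat_trdeg_range t
  have h1 := hB n z hz
  have h2 := trdeg_le_of_aeval z t N E hzN hzE
  rw [hm] at h2
  have h3 : (n : Cardinal) ≤ (m : Cardinal) + 1 := h1.trans (add_le_add h2 le_rfl)
  have h4 : n ≤ m + 1 := by exact_mod_cast h3
  have hmk' : m = k := by omega
  refine ⟨by omega, algebraicIndependent_of_le_trdeg_adjoin t ?_⟩
  have hkm : (k : Cardinal) ≤ (m : Cardinal) := by exact_mod_cast hmk'.ge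
  exact hkm.trans hm.symm.le

/-! ## 2. Quadratic polynomials over ℚ̄ -/

/-- `b₀ + Σ_j b_j X_j + Σ_{j,j'} d_{jj'} X_j X_{j'}` over ℚ̄. -/
def quad {k : ℕ} (b₀ : Qbar) (b : Fin k → Qbar) (d : Fin k → Fin k → Qbar) :
    MvPolynomial (Fin k) Qbar :=
  MvPolynomial.C b₀ + ∑ j, MvPolynomial.C (b j) * MvPolynomial.X j +
    ∑ j, ∑ j', MvPolynomial.C (d j j') * (MvPolynomial.X j * MvPolynomial.X j')

/-- Evaluation of the quadratic polynomial `quad b₀ b d`. -/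
theorem aeval_quad {k : ℕ} (t : Fin k → ℂ) (b₀ : Qbar) (b : Fin k → Qbar) (d : Fin k → Fin k → Qbar) :
    MvPolynomial.aeval t (quad b₀ b d) =
      (b₀ : ℂ) + ∑ j, (b j : ℂ) * t j + ∑ j, ∑ j', (d j j' : ℂ) * (t j * t j') := by
  simp [quad, map_add, map_sum, map_mul, MvPolynomial.aeval_X]

/-- `quad b₀ b d` has total degree `≤ 2`. -/
theorem totalDegree_quad_le {k : ℕ} (b₀ : Qbar) (b : Fin k → Qbar) (d : Fin k → Fin k → Qbar) :
    (quad b₀ b d).totalDegree ≤ 2 := by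
  unfold quad
  have hX : ∀ j : Fin k, (MvPolynomial.X j : MvPolynomial (Fin k) Qbar).totalDegree ≤ 1 := fun j => by
    rw [MvPolynomial.totalDegree_X]
  refine (MvPolynomial.totalDegree_add _ _).trans (max_le ((MvPolynomial.totalDegree_add _ _).trans
    (max_le ?_ ?_)) ?_)
  · simp [MvPolynomial.totalDegree_C]
  · refine (MvPolynomial.totalDegree_finsetSum _ _).trans (Finset.sup_le fun j _ => ?_)
    refine (MvPolynomial.totalDegree_mul _ _).trans ?_
    have := hX j
    simp only [MvPolynomial.totalDegree_C, zero_add]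
    omega
  · refine (MvPolynomial.totalDegree_finsetSum _ _).trans (Finset.sup_le fun j _ => ?_)
    refine (MvPolynomial.totalDegree_finsetSum _ _).trans (Finset.sup_le fun j' _ => ?_)
    refine (MvPolynomial.totalDegree_mul _ _).trans ?_
    have h1 := (MvPolynomial.totalDegree_mul (MvPolynomial.X j : MvPolynomial (Fin k) Qbar)
      (MvPolynomial.X j')).trans (add_le_add (hX j) (hX j'))
    simp only [MvPolynomial.totalDegree_C, zero_add]
    omega

/-! ## 3. The gadget `(t₀^{d+1}, t₀^{d+2})` is quadratically rigid -/

/-- If `P^{d+2} = Q^{d+1}` for nonzero polynomials of total degree ≤ 2 over a domain and `d ≥ 1`,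
then `P` is constant. -/
theorem gadget_rigid {σ R : Type*} [CommRing R] [IsDomain R] {d : ℕ} (hd : 1 ≤ d)
    {P Q : MvPolynomial σ R} (hP0 : P ≠ 0) (hQ0 : Q ≠ 0)
    (hP : P.totalDegree ≤ 2) (hQ : Q.totalDegree ≤ 2) (h : P ^ (d + 2) = Q ^ (d + 1)) :
    P.totalDegree = 0 := by
  have hdeg := congrArg MvPolynomial.totalDegree h
  rw [totalDegree_pow_of_ne_zero hP0, totalDegree_pow_of_ne_zero hQ0] at hdeg
  generalize hu : P.totalDegree = u at hdeg hP
  generalize hv : Q.totalDegree = v at hdeg hQ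
  interval_cases u <;> interval_cases v <;> first | rfl | (exfalso; nlinarith) 

/-! ## 4. Padding a bounded-degree polynomial tuple keeps it ℚ-linearly independent -/

/-- A monomial of degree above the total degree has coefficient zero. -/
theorem coeff_single_eq_zero_of_totalDegree_le {k d e : ℕ} {P : MvPolynomial (Fin k) Qbar}
    (hP : P.totalDegree ≤ d) (hde : d < e) (j₀ : Fin k) :
    MvPolynomial.coeff (Finsupp.single j₀ e) P = 0 := by
  apply MvPolynomial.coeff_eq_zero_of_totalDegree_lt
  have he : e ≠ 0 := by omega
  rw [Finsupp.support_single _ he, Finset.sum_singleton, Finsupp.single_eq_same]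
  omega

/-- The padded tuple `(z, t_{j₀}^{d+1}, t_{j₀}^{d+2})` is ℚ-linearly independent when `z` is,
`z ⊂ ℚ̄[t]_{≤ d}` and `t` is algebraically independent over ℚ̄. -/
theorem linearIndependent_pad {n k d : ℕ} (z : Fin n → ℂ) (t : Fin k → ℂ)
    (hz : LinearIndependent ℚ z) (ht : AlgebraicIndependent Qbar t)
    (N : Fin n → MvPolynomial (Fin k) Qbar) (hN : ∀ i, (N i).totalDegree ≤ d)
    (hzN : ∀ i, z i = MvPolynomial.aeval t (N i)) (j₀ : Fin k) :
    LinearIndependent ℚ (Fin.append (n := 2) z ![t j₀ ^ (d + 1), t j₀ ^ (d + 2)]) := by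
  classical
  rw [Fintype.linearIndependent_iff]
  intro g hg
  rw [Fin.sum_univ_add, Fin.sum_univ_two] at hg
  simp only [Fin.append_left, Fin.append_right, Matrix.cons_val_zero, Matrix.cons_val_one] at hg
  -- hg : ∑ i, g (castAdd 2 i) • z i + (b • t j₀ ^ (d+1) + c • t j₀ ^ (d+2)) = 0
  let b : ℚ := g (Fin.natAdd n 0)
  let c : ℚ := g (Fin.natAdd n 1)
  -- the relation as a polynomial identity over ℚ̄
  set Pg : MvPolynomial (Fin k) Qbar :=
    ∑ i, MvPolynomial.C (algebraMap ℚ Qbar (g (Fin.castAdd 2 i))) * N i +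
      MvPolynomial.C (algebraMap ℚ Qbar b) * MvPolynomial.X j₀ ^ (d + 1) +
      MvPolynomial.C (algebraMap ℚ Qbar c) * MvPolynomial.X j₀ ^ (d + 2) with hPg
  have hcoe : ∀ q : ℚ, (algebraMap Qbar ℂ) (algebraMap ℚ Qbar q) = (q : ℂ) := fun q => rfl
  have haeval : MvPolynomial.aeval t Pg = 0 := by
    rw [← hg]
    simp only [hPg, b, c, map_add, map_sum, map_mul, map_pow, MvPolynomial.aeval_C,
      MvPolynomial.aeval_X, hcoe, ← hzN, Rat.smul_def]
    ring
  have hPg0 : Pg = 0 := ht (by rw [haeval, map_zero])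
  have hNc : ∀ i (e : ℕ), d < e → MvPolynomial.coeff (Finsupp.single j₀ e) (N i) = 0 :=
    fun i e he => coeff_single_eq_zero_of_totalDegree_le (hN i) he j₀
  have hne : Finsupp.single j₀ (d + 2) ≠ Finsupp.single j₀ (d + 1) := fun h => by
    have := Finsupp.single_injective j₀ h
    omega
  have hb0 : b = 0 := by
    have h := congrArg (MvPolynomial.coeff (Finsupp.single j₀ (d + 1))) hPg0
    simp only [hPg, MvPolynomial.coeff_add, MvPolynomial.coeff_sum, MvPolynomial.coeff_C_mul,
      MvPolynomial.X_pow_eq_monomial, MvPolynomial.coeff_monomial, hNc _ (d + 1) (by omega),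
      mul_zero, Finset.sum_const_zero, zero_add, if_true, mul_one, if_neg hne,
      add_zero, MvPolynomial.coeff_zero] at h
    have h' := congrArg (fun x : Qbar => (x : ℂ)) h
    simp only [ZeroMemClass.coe_zero] at h'
    exact_mod_cast (show ((b : ℂ)) = 0 from h')
  have hc0 : c = 0 := by
    have h := congrArg (MvPolynomial.coeff (Finsupp.single j₀ (d + 2))) hPg0
    simp only [hPg, MvPolynomial.coeff_add, MvPolynomial.coeff_sum, MvPolynomial.coeff_C_mul,
      MvPolynomial.X_pow_eq_monomial, MvPolynomial.coeff_monomial, hNc _ (d + 2) (by omega),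
      mul_zero, Finset.sum_const_zero, zero_add, if_true, mul_one, if_neg hne.symm,
      add_zero, MvPolynomial.coeff_zero] at h
    have h' := congrArg (fun x : Qbar => (x : ℂ)) h
    simp only [ZeroMemClass.coe_zero] at h'
    exact_mod_cast (show ((c : ℂ)) = 0 from h')
  -- the relation among the z's
  have hgz : ∑ i, g (Fin.castAdd 2 i) • z i = 0 := by
    have h := hg
    rw [show g (Fin.natAdd n 0) = b from rfl, show g (Fin.natAdd n 1) = c from rfl, hb0, hc0,
      zero_smul, zero_smul, add_zero, add_zero] at h
    exact h
  have hz0 := (Fintype.linearIndependent_iff.mp hz) (fun i => g (Fin.castAdd 2 i)) hgz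
  intro i
  refine Fin.addCases (fun i => hz0 i) (fun j => ?_) i
  fin_cases j
  · exact hb0
  · exact hc0

/-! ## 5. The padded tuple is affinely and quadratically non-degenerate (under B) -/

/-- **Quadratic non-degeneracy of a tuple containing `u^{d+1}` and `u^{d+2}` (`u` transcendental).**
Under B, a ℚ-l.i. tuple `x` of length `N` containing the two powers admits no ℚ̄-quadratic
parametrisation (together with `e^x`) by fewer than `N` numbers. -/
theorem pad_quadratic_clause (hB : DefectOneSchanuel) {N d : ℕ} (hd : 1 ≤ d) (x : Fin N → ℂ)
    (hx : LinearIndependent ℚ x) (u : ℂ) (hu : Transcendental ℚ u) (i₁ i₂ : Fin N)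
    (hx₁ : x i₁ = u ^ (d + 1)) (hx₂ : x i₂ = u ^ (d + 2)) :
    ∀ (k' : ℕ) (t' : Fin k' → ℂ) (β₀ γ₀ : Fin N → ℂ) (β γ : Fin N → Fin k' → ℂ)
      (δ ε : Fin N → Fin k' → Fin k' → ℂ),
      (∀ i, IsAlgebraic ℚ (β₀ i)) → (∀ i j, IsAlgebraic ℚ (β i j)) →
      (∀ i j j', IsAlgebraic ℚ (δ i j j')) → (∀ i, IsAlgebraic ℚ (γ₀ i)) →
      (∀ i j, IsAlgebraic ℚ (γ i j)) → (∀ i j j', IsAlgebraic ℚ (ε i j j')) →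
      (∀ i, x i = β₀ i + ∑ j, β i j * t' j + ∑ j, ∑ j', δ i j j' * (t' j * t' j')) →
      (∀ i, Complex.exp (x i) = γ₀ i + ∑ j, γ i j * t' j + ∑ j, ∑ j', ε i j j' * (t' j * t' j')) →
      N ≤ k' := by
  intro k' t' β₀ γ₀ β γ δ ε hβ₀ hβ hδ hγ₀ hγ hε hxr her
  by_contra hlt
  push Not at hlt
  -- the parametrisation as ℚ̄-polynomials
  set P : Fin N → MvPolynomial (Fin k') Qbar := fun i =>
    quad ⟨β₀ i, hβ₀ i⟩ (fun j => ⟨β i j, hβ i j⟩) (fun j j' => ⟨δ i j j', hδ i j j'⟩) with hPdef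
  set R : Fin N → MvPolynomial (Fin k') Qbar := fun i =>
    quad ⟨γ₀ i, hγ₀ i⟩ (fun j => ⟨γ i j, hγ i j⟩) (fun j j' => ⟨ε i j j', hε i j j'⟩) with hRdef
  have hxP : ∀ i, x i = MvPolynomial.aeval t' (P i) := fun i => by
    rw [hPdef, aeval_quad]; exact hxr i
  have hxR : ∀ i, cexp (x i) = MvPolynomial.aeval t' (R i) := fun i => by
    rw [hRdef, aeval_quad]; exact her i
  obtain ⟨hN, ht'⟩ := numerics hB x t' hx P R hxP hxR hlt
  have ht'S : AlgebraicIndependent Qbar t' := ht'.subalgebraAlgebraicClosure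
  have hu0 : u ≠ 0 := fun h => hu (h ▸ isAlgebraic_zero)
  -- the gadget identity P₁^{d+2} = P₂^{d+1}
  have h1 : MvPolynomial.aeval t' (P i₁) = u ^ (d + 1) := by rw [← hxP i₁, hx₁]
  have h2 : MvPolynomial.aeval t' (P i₂) = u ^ (d + 2) := by rw [← hxP i₂, hx₂]
  have hP10 : P i₁ ≠ 0 := fun h => by
    rw [h, map_zero] at h1
    exact pow_ne_zero _ hu0 h1.symm
  have hP20 : P i₂ ≠ 0 := fun h => by
    rw [h, map_zero] at h2
    exact pow_ne_zero _ hu0 h2.symm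
  have hid : P i₁ ^ (d + 2) = P i₂ ^ (d + 1) := ht'S (by
    rw [map_pow, map_pow, h1, h2, ← pow_mul, ← pow_mul, Nat.mul_comm])
  have hdeg0 := gadget_rigid hd hP10 hP20 (totalDegree_quad_le _ _ _) (totalDegree_quad_le _ _ _) hid
  -- so P i₁ is a constant and u^{d+1} is algebraic
  rw [MvPolynomial.totalDegree_eq_zero_iff_eq_C] at hdeg0
  have halg : IsAlgebraic ℚ (u ^ (d + 1)) := by
    rw [← h1, hdeg0, MvPolynomial.aeval_C, Subalgebra.algebraMap_def]
    exact (MvPolynomial.coeff 0 (P i₁)).2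
  exact hu.pow (by omega) halg

end Summit.Schanuel.Schanuel.Theorems.RootDecomp1LadderCollapse
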